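import Mathlib
import HarnessLib
import Summits.ResolutionOfSingularities.ResolutionOfSingularities.Theorems.WildQuotientsWildQuotientResolutionS1aKillCertCoverSupp

/-!
# S1a — THE PRINCIPAL CENTRE OF A CERTIFICATE COVER, WITH ITS FILTRATION AND SUPPORT RECORDED

[OURS · L1 W4.5c · lead-1 g10; FRAME-STATUS rev11 (F6) / §4 item 4] — NOT statements of the manuscript; counted 0; AI-level work, weaker than expert review.
Crux stmt-ResolutionOfSingularities-17941 `CyclicQuotientFourfolds`, line `s1a-logminvertex` v10, K-side. Route-independent.

`exists_isPrincipalCentre_supp_le_of_certCover` (p643341) returns `∃ 𝒦 d, IsPrincipalCentre … ∧ supp ⊆ B ∧ ∀ i, IsPrincipalCentreChart … (O i)`, hiding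
WHICH filtration `𝒦` is. For statements at explicit models («the (3,2,1)-centre on the fixed axis IS a legal kill move») the construction must be
remembered: `𝒦` is the gluing of the chart filtrations, so on each chart `O_i` its filtration IS the weighted filtration of `(f_i, w_i)` and its support
there IS `V(f_i) ∩ O_i`.
* `KillCert.weightedFiltration_ideal_le_span` — `𝒥ₙ(f, w) ≤ (f)` for `0 < n`;
* `KillGlue.exists_isPrincipalCentre_of_agree_filtration_eq` — the gluing theorem (p643066) recording `(J|O_i)_n = (𝒦_i|O_i)_n`;
* ★★ `GameFrame.GModel.exists_isPrincipalCentre_filtration_eq_of_certCover` — the cover theorem recording `(𝒦|O_i)_n = 𝒥ₙ(f_i, w_i)` and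
  `V(f_i) ∩ O_i ⊆ supp 𝒦_d` (so `supp 𝒦_d ∩ O_i = V(f_i) ∩ O_i`).
-/

set_option linter.dupNamespace false

noncomputable section

universe u v

open CategoryTheory Limits AlgebraicGeometry TopologicalSpace Topology Opposite
open Literature.AlgebraicGeometry.Resolution Literature.AlgebraicGeometry.RelativeSpec
open Summit.ResolutionOfSingularities.ResolutionOfSingularities.Theorems.WildQuotientResolution.S1
open Summit.ResolutionOfSingularities.ResolutionOfSingularities.Theorems.WildQuotientResolution.S1.NodeAtlas
open Summit.ResolutionOfSingularities.ResolutionOfSingularities.Theorems.WildQuotientResolution.S1.ProducerStep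
open Summit.ResolutionOfSingularities.ResolutionOfSingularities.Theorems.WildQuotientResolution.S1.CoarseChart
open Summit.ResolutionOfSingularities.ResolutionOfSingularities.Theorems.WildQuotientResolution.S1.ChartData
open Summit.ResolutionOfSingularities.ResolutionOfSingularities.Theorems.WildQuotientResolution.S1.BlowupCharts
open Summit.ResolutionOfSingularities.ResolutionOfSingularities.Theorems.WildQuotientResolution.S1.KillFamily
open Summit.ResolutionOfSingularities.ResolutionOfSingularities.Theorems.WildQuotientResolution.S1.CentreGluing
open Summit.ResolutionOfSingularities.ResolutionOfSingularities.Theorems.WildQuotientResolution.S1.ExtendRees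
open Summit.ResolutionOfSingularities.ResolutionOfSingularities.Theorems.WildQuotientResolution.S1.NodeChartAway
open Summit.ResolutionOfSingularities.ResolutionOfSingularities.Theorems.WildQuotientResolution.S1.KillGlue
open Summit.ResolutionOfSingularities.ResolutionOfSingularities.Theorems.WildQuotientResolution.S1.KillCert

namespace Summit.ResolutionOfSingularities.ResolutionOfSingularities.Theorems.WildQuotientResolution.S1.KillCert

/-- `𝒥ₙ(u, w) ≤ (u)` for `0 < n`: a monomial of positive weight has a factor `uᵢ`. [folklore] -/
theorem weightedFiltration_ideal_le_span {A : Type*} [CommRing A] {ι : Type*} (u : ι → A) (w : ι → ℕ) {n : ℕ} (hn : 0 < n) :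
    (weightedFiltration u w).ideal n ≤ Ideal.span (Set.range u) := by
  classical
  rw [weightedFiltration_ideal, Ideal.span_le]
  rintro _ ⟨α, hα, rfl⟩
  have hα0 : α ≠ 0 := by
    rintro rfl
    rw [map_zero] at hα
    omega
  obtain ⟨i, hmem⟩ := Finsupp.support_nonempty_iff.mpr hα0
  have hi : α i ≠ 0 := Finsupp.mem_support_iff.mp hmem
  obtain ⟨c, hc⟩ : u i ^ α i ∣ α.prod (fun i e => u i ^ e) := Finset.dvd_prod_of_mem (fun j => u j ^ α j) hmem
  obtain ⟨m, hm⟩ := Nat.exists_eq_succ_of_ne_zero hi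
  rw [SetLike.mem_coe, hc, hm, pow_succ', mul_assoc]
  exact Ideal.mul_mem_right _ _ (Ideal.subset_span ⟨i, rfl⟩)

end Summit.ResolutionOfSingularities.ResolutionOfSingularities.Theorems.WildQuotientResolution.S1.KillCert

namespace Summit.ResolutionOfSingularities.ResolutionOfSingularities.Theorems.WildQuotientResolution.S1.KillGlue

variable {p : ℕ} {X' X₁ : Scheme.{0}} {q : X' ⟶ X₁} {G : Type} [Group G] {ρ : G →* Aut X'} {g₀ : G}

/-- **AGREEING PRINCIPAL CHARTS GLUE TO A PRINCIPAL CENTRE — with the glued filtration recorded**: as `exists_isPrincipalCentre_of_agree_supp_le`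
(p643066), plus `(J|O_i)_n = (𝒦_i|O_i)_n` for every chart. [OURS · L1 W4.5c; NOT a statement of the manuscript] -/
theorem exists_isPrincipalCentre_of_agree_filtration_eq [Finite G] (hG : ∀ g : G, g ∈ Subgroup.zpowers g₀) (M : GameFrame.GModel p q G ρ g₀)
    [M.V.IsSeparated] {ι : Type} [Finite ι]
    (O : ι → M.act.StableAffineOpens) (hO : ∀ i, IsAffineOpen (O i).1) (𝒦 : ι → ReesFiltration M.V) {d : ℕ} (hd : 0 < d)
    (hprin : ∀ i, IsPrincipalCentreChart p M.act g₀ (𝒦 i) d (O i))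
    (hagree : ∀ i k (U : M.V.affineOpens), U.1 ≤ (O i).1 → U.1 ≤ (O k).1 → ∀ n, ((𝒦 i).filtration U).ideal n = ((𝒦 k).filtration U).ideal n)
    {B : Set M.V} (hBc : IsClosed B) (hBcov : B ⊆ ⋃ i, ((O i).1 : Set M.V))
    (hsupp : ∀ i, (((𝒦 i).ideal d).support : Set M.V) ∩ (O i).1 ⊆ B) :
    ∃ J : ReesFiltration M.V, IsPrincipalCentre p M.act g₀ J d ∧ (((J.ideal d).support : Set M.V) ⊆ B) ∧
      (∀ i, IsPrincipalCentreChart p M.act g₀ J d (O i)) ∧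
      ∀ i n, (J.filtration ⟨(O i).1, hO i⟩).ideal n = ((𝒦 i).filtration ⟨(O i).1, hO i⟩).ideal n := by
  haveI : IsLocallyNoetherian M.V := M.isLocallyNoetherian
  let J : ReesFiltration M.V := glue M.act O 𝒦
  have hJeq : ∀ i n, (J.filtration ⟨(O i).1, hO i⟩).ideal n = ((𝒦 i).filtration ⟨(O i).1, hO i⟩).ideal n := fun i n =>
    filtration_glue_eq O 𝒦 hO hagree i n
  have hJO : ∀ i, IsPrincipalCentreChart p M.act g₀ J d (O i) := fun i =>
    isPrincipalCentreChart_congr (hprin i) fun hO n => filtration_glue_eq O 𝒦 (fun i => (hprin i).1) hagree i n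
  have hGst : ∀ (g : G) (n : ℕ), (J.ideal n).comap (M.act.aut g).hom = J.ideal n := comap_aut_glue hG O 𝒦 hprin
  have hsub : ((J.ideal d).support : Set M.V) ⊆ B := by
    refine (support_glue_subset (ρ := M.act) O 𝒦 d).trans (Set.iUnion_subset fun i => ?_)
    exact closure_minimal (hsupp i) hBc
  refine ⟨J, ⟨hd, hGst, fun v => ?_⟩, hsub, hJO, hJeq⟩
  by_cases hv : v ∈ ((J.ideal d).support : Set M.V)
  · obtain ⟨i, hvi⟩ := Set.mem_iUnion.mp (hBcov (hsub hv))
    exact ⟨O i, hvi, Or.inl (hJO i)⟩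
  · obtain ⟨O₀, hvO₀, hn⟩ := M.atlas v
    obtain ⟨O'', hvO'', -, hO''W, hn''⟩ := exists_isNodeChart_le hn hvO₀ (J.ideal d).support.compl
      (preimage_support_compl M.act (fun g => hGst g d)) hv
    refine ⟨O'', hvO'', Or.inr ⟨hn'', fun n => filtration_eq_top_of_disjoint _ hd ⟨O''.1, hn''.1⟩ ?_ n⟩⟩
    rw [Set.disjoint_left]
    intro x hx hx'
    exact hO''W hx hx'

end Summit.ResolutionOfSingularities.ResolutionOfSingularities.Theorems.WildQuotientResolution.S1.KillGlue

namespace Summit.ResolutionOfSingularities.ResolutionOfSingularities.Theorems.WildQuotientResolution.S1.GameFrame.GModel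

open GoodCharts

variable {p : ℕ} {X' X₁ : Scheme.{0}} {q : X' ⟶ X₁} {G : Type} [Group G] {ρ : G →* Aut X'} {g₀ : G}

/-- ★★ **THE PRINCIPAL CENTRE OF A CERTIFICATE COVER, WITH ITS FILTRATION AND SUPPORT** — `exists_isPrincipalCentre_supp_le_of_certCover` (p643341; same
hypotheses, same construction) recording in addition that ON EACH CHART the centre's filtration IS the weighted filtration `𝒥ₙ(f_i, w_i)` and its support
CONTAINS `V(f_i) ∩ O_i`. [OURS · L1 W4.5c · FRAME-STATUS rev11 (F6); NOT a statement of the manuscript] -/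
theorem exists_isPrincipalCentre_filtration_eq_of_certCover [Finite G] (hG : ∀ g : G, g ∈ Subgroup.zpowers g₀) (hg₀ : g₀ ^ p = 1)
    (M : GModel p q G ρ g₀) [M.V.IsSeparated] (hreg : Scheme.IsRegular M.V)
    {ι : Type} [Finite ι] (O : ι → M.act.StableAffineOpens) (hO : ∀ i, IsAffineOpen (O i).1)
    (c : ι → ℕ) (f : ∀ i, Fin (c i) → Γ(M.V, (O i).1)) (w : ∀ i, Fin (c i) → ℕ) (hc : ∀ i, 0 < c i) (hw : ∀ i k, 0 < w i k)
    (hK1 : ∀ i, RingTheory.Sequence.IsRegular Γ(M.V, (O i).1) (List.ofFn (f i)))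
    (hK1' : ∀ i, IsRegularRing (Γ(M.V, (O i).1) ⧸ Ideal.span (Set.range (f i))))
    (hσJ : ∀ i (n : ℕ), ((weightedFiltration (f i) (w i)).ideal n).map (actOEquiv M.act (O i) g₀ : Γ(M.V, (O i).1) →+* Γ(M.V, (O i).1)) ≤
      (weightedFiltration (f i) (w i)).ideal n)
    (hcert : ∀ i (hp' : 0 < p) (hσp : ∀ x, (⇑(actOEquiv M.act (O i) g₀))^[p] x = x),
      ∃ g, CobordantKillCert (f i) (w i) (actOEquiv M.act (O i) g₀) (hσJ i) hp' hσp g)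
    (hagree : ∀ i j (U : M.V.affineOpens) (hi : U.1 ≤ (O i).1) (hj : U.1 ≤ (O j).1) (n : ℕ),
      ((weightedFiltration (f i) (w i)).ideal n).map (M.V.presheaf.map (homOfLE hi).op).hom =
        ((weightedFiltration (f j) (w j)).ideal n).map (M.V.presheaf.map (homOfLE hj).op).hom)
    {B : Set M.V} (hBc : IsClosed B) (hBcov : B ⊆ ⋃ i, ((O i).1 : Set M.V))
    (hsupp : ∀ i, M.V.zeroLocus (U := (O i).1) (Set.range (f i)) ∩ ((O i).1 : Set M.V) ⊆ B) :
    ∃ (𝒦 : ReesFiltration M.V) (d : ℕ), IsPrincipalCentre p M.act g₀ 𝒦 d ∧ (((𝒦.ideal d).support : Set M.V)) ⊆ B ∧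
      (∀ i, IsPrincipalCentreChart p M.act g₀ 𝒦 d (O i)) ∧
      (∀ i n, (𝒦.filtration ⟨(O i).1, hO i⟩).ideal n = (weightedFiltration (f i) (w i)).ideal n) ∧
      ∀ i, M.V.zeroLocus (U := (O i).1) (Set.range (f i)) ∩ ((O i).1 : Set M.V) ⊆ ((𝒦.ideal d).support : Set M.V) := by
  classical
  haveI : IsLocallyNoetherian M.V := M.isLocallyNoetherian
  haveI : Fintype ι := Fintype.ofFinite ι
  -- the trivial node on each chart
  have hnode : ∀ i, ∃ (𝒜 : (Π j : Fin 0, ZMod ((![] : Fin 0 → ℕ) j)) → AddSubgroup Γ(M.V, (O i).1)) (_ : GradedRing 𝒜),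
      (∀ e, 𝒜 e = ⊤) ∧ ∃ e : Γ(M.V, (O i).1) ≃+* ↥(𝒜 0), ∀ b, ((e b : ↥(𝒜 0)) : Γ(M.V, (O i).1)) = b :=
    fun i => exists_trivialGradedRing _ _
  choose 𝒜 gr h𝒜 e he using hnode
  -- Veronese degrees, and a common one
  have hver₀ : ∀ i, ∃ d : ℕ, letI := gr i; VeroneseNormalised (𝒜 i) (f i) (w i) d := by
    intro i
    letI := gr i
    refine Veronese.veroneseNormalisation _ _ (𝒜 i) ⟨∅, ?_⟩ (c i) (f i) (fun _ => 0) (w i) (fun k => by rw [h𝒜 i]; trivial)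
    rw [h𝒜 i 0, Finset.coe_empty, Set.union_empty]
    exact top_le_iff.mp fun x _ => Subring.subset_closure trivial
  choose d hd using hver₀
  let D : ℕ := ∏ i, d i
  have hdpos : ∀ i, 0 < d i := fun i => by letI := gr i; exact (hd i).1
  have hD : ∀ i, letI := gr i; VeroneseNormalised (𝒜 i) (f i) (w i) D := by
    intro i
    letI := gr i
    have e1 : D = d i * ∏ j ∈ Finset.univ.erase i, d j := (Finset.mul_prod_erase Finset.univ d (Finset.mem_univ i)).symm
    rw [e1]
    exact CoarseChart.veroneseNormalised_mul (𝒜 i) (f i) (w i) (hd i) (Finset.prod_pos fun j _ => hdpos j)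
  have hDpos : 0 < D := Finset.prod_pos fun j _ => hdpos j
  -- the chart filtrations
  let K : ∀ i, IdealFiltration Γ(M.V, (O i).1) := fun i => weightedFiltration (f i) (w i)
  let 𝒦 : ι → ReesFiltration M.V := fun i => chartFiltration (O i).1 (K i)
  have h𝒦O : ∀ i n, ((𝒦 i).filtration ⟨(O i).1, hO i⟩).ideal n = (weightedFiltration (f i) (w i)).ideal n := fun i n =>
    filtration_chartFiltration (O i).1 (hO i) (K i) n
  have h𝒦O' : ∀ i n, ((𝒦 i).filtration ⟨(O i).1, hO i⟩).ideal n =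
      (letI := gr i; ((traceFiltration (𝒜 i) (f i) (w i)).ideal n).comap ((e i : Γ(M.V, (O i).1) →+* ↥(𝒜 i 0)))) := by
    intro i n
    letI := gr i
    rw [h𝒦O]
    ext t
    rw [Ideal.mem_comap, mem_traceFiltration_iff, RingHom.coe_coe, he]
  -- each chart is a principal-centre chart
  have hprin : ∀ i, IsPrincipalCentreChart p M.act g₀ (𝒦 i) D (O i) := by
    intro i
    letI := gr i
    haveI : IsNoetherianRing Γ(M.V, (O i).1) := IsLocallyNoetherian.component_noetherian ⟨(O i).1, hO i⟩
    have hregi : IsRegularRing Γ(M.V, (O i).1) := hreg.isRegularRing_of_isAffineOpen (hO i)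
    have hσp : ∀ x, (⇑(actOEquiv M.act (O i) g₀))^[p] x = x := fun x => actOEquiv_iterate_eq_self M.act (O i) hg₀ x
    have htame : IsTameNode p Γ(M.V, (O i).1) (𝒜 i) (actOEquiv M.act (O i) g₀) := by
      refine ⟨inferInstance, hregi, ?_, ?_, ?_, hσp⟩
      · exact ⟨∅, fun _ h => absurd h (Finset.notMem_empty _), inferInstance⟩
      · refine ⟨∅, eq_top_iff.mpr fun b _ => Subring.subset_closure (Or.inl ?_)⟩
        rw [h𝒜 i 0]; exact AddSubgroup.mem_top b
      · intro d' b _; rw [h𝒜 i d']; exact AddSubgroup.mem_top _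
    refine ⟨hO i, 0, ![], Γ(M.V, (O i).1), inferInstance, 𝒜 i, gr i, actOEquiv M.act (O i) g₀, e i, htame, fun t => ?_, c i, f i,
      fun _ => 0, w i, hc i, fun k => ?_, hw i, hK1 i, hK1' i, hσJ i, h𝒦O' i, hD i, ?_⟩
    · rw [he, he]; rfl
    · rw [h𝒜 i]; trivial
    · intro hp' hσp' d' b hb hσb hd'
      obtain ⟨g, hg⟩ := hcert i hp' hσp'
      exact isPrincipal_augmentationIdeal_sigmaChart_of_cert (f i) (w i) _ (hσJ i) hp' hσp' (𝒜 i) hd' b hb hσb hg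
  -- agreement on common affine opens
  have hagree' : ∀ i j (U : M.V.affineOpens), U.1 ≤ (O i).1 → U.1 ≤ (O j).1 →
      ∀ n, ((𝒦 i).filtration U).ideal n = ((𝒦 j).filtration U).ideal n := by
    intro i j U hi hj n
    have ei : ((𝒦 i).filtration U).ideal n = ((weightedFiltration (f i) (w i)).ideal n).map (M.V.presheaf.map (homOfLE hi).op).hom := by
      rw [← h𝒦O i n, ReesFiltration.filtration_ideal, ReesFiltration.filtration_ideal]
      exact (((𝒦 i).ideal n).map_ideal (U := U) (V := ⟨(O i).1, hO i⟩) hi).symm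
    have ej : ((𝒦 j).filtration U).ideal n = ((weightedFiltration (f j) (w j)).ideal n).map (M.V.presheaf.map (homOfLE hj).op).hom := by
      rw [← h𝒦O j n, ReesFiltration.filtration_ideal, ReesFiltration.filtration_ideal]
      exact (((𝒦 j).ideal n).map_ideal (U := U) (V := ⟨(O j).1, hO j⟩) hj).symm
    rw [ei, ej, hagree i j U hi hj n]
  -- supports inside `B`
  have hsupp' : ∀ i, ((((𝒦 i).ideal D).support : Set M.V)) ∩ ((O i).1 : Set M.V) ⊆ B := by
    intro i x ⟨hx, hxO⟩
    have hZ : x ∈ M.V.zeroLocus (U := (O i).1) (((K i).ideal D : Ideal Γ(M.V, (O i).1)) : Set Γ(M.V, (O i).1)) :=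
      (mem_support_chartFiltration_iff (O i).1 (hO i) (K i) D hxO).mp hx
    refine hsupp i ⟨?_, hxO⟩
    -- `V(𝒥_D) ⊆ V(I^D) = V(I) = V(range f)`
    have hID : Ideal.span (Set.range (f i)) ^ D ≤ (K i).ideal D := by
      have h1 : Ideal.span (Set.range (f i)) ≤ (K i).ideal 1 := by
        rw [Ideal.span_le]
        rintro _ ⟨k, rfl⟩
        exact (weightedFiltration (f i) (w i)).antitone (hw i k) (mem_weightedFiltration_ideal (f i) (w i) k)
      refine (Ideal.pow_right_mono h1 D).trans ?_
      have := Veronese.idealFiltration_pow_le (K i) 1 D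
      rwa [one_mul] at this
    have h2 : x ∈ M.V.zeroLocus (U := (O i).1) ((Ideal.span (Set.range (f i)) ^ D : Ideal Γ(M.V, (O i).1)) : Set Γ(M.V, (O i).1)) :=
      M.V.zeroLocus_mono (SetLike.coe_subset_coe.mpr hID) hZ
    rw [← Scheme.zeroLocus_radical, Ideal.radical_pow _ hDpos.ne', Scheme.zeroLocus_radical, Scheme.zeroLocus_span] at h2
    exact h2
  obtain ⟨J, hJ, hJsupp, hJO, hJeq⟩ := exists_isPrincipalCentre_of_agree_filtration_eq hG M O hO 𝒦 hDpos hprin hagree' hBc hBcov hsupp'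
  have hJw : ∀ i n, (J.filtration ⟨(O i).1, hO i⟩).ideal n = (weightedFiltration (f i) (w i)).ideal n := fun i n => by rw [hJeq, h𝒦O]
  refine ⟨J, D, hJ, hJsupp, hJO, hJw, fun i x hx => ?_⟩
  obtain ⟨hxZ, hxO⟩ := hx
  rw [SetLike.mem_coe, Scheme.IdealSheafData.mem_support_iff_of_mem (U := ⟨(O i).1, hO i⟩) hxO, ← ReesFiltration.filtration_ideal, hJw]
  rw [← Scheme.zeroLocus_span] at hxZ
  exact M.V.zeroLocus_mono (SetLike.coe_subset_coe.mpr (weightedFiltration_ideal_le_span (f i) (w i) hDpos)) hxZ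

end Summit.ResolutionOfSingularities.ResolutionOfSingularities.Theorems.WildQuotientResolution.S1.GameFrame.GModel

end
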